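import Literature.Algebra.Homology.OrderedCechSystemCupClasses
import Literature.Algebra.Homology.OrderedCechSystemCupRefine
import Literature.Algebra.Homology.OrderedCechSystemRefineMap
import Literature.AlgebraicGeometry.Modules.CechPullbackSystemHom
import Literature.AlgebraicGeometry.Modules.CechUnitModuleHZeroScalars
import Mathlib.LinearAlgebra.TensorProduct.Finiteness
import HarnessLib

/-!
# Pull-backs on ordered Čech classes: monotone multiplicativity, units, identity index maps, composite data, and the
# cocycle decomposition behind a surjective cup product (Stacks 01FG/01FP; Godement II §6.6; Mumford AV §13)

PROOF file (theorems only; no definition, no instance, no notation, no named fact) over ★ D25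
`Algebra/Homology/OrderedCechSystemRefineMap` (`refineComplexMap τ φ : Č(M) ⟶ Č(M')`), ★ `OrderedCechSystemCupClasses` (`cupH`),
★ `OrderedCechSystemCupRefine` (`refineCochain_cup`, monotone `τ`), ★ `Modules/CechPullbackSystemHom` (`pullbackSystemHom`) and ★
`Modules/CechUnitModuleHZeroScalars` (`exists_cycles_eq`).  The class-level bookkeeping consumed by the F-J3b assembly
(`AbelianSchemes/AbelianVarietyCechCupSurjective`, «`Ȟ¹ ⊗ Ȟ¹ ↠ Ȟ²` for abelian varieties»):

* §1 `homologyMap_refineComplexMap_cupH` — refinement along a MONOTONE index map is multiplicative on classes (no Leray hypothesis;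
  the non-monotone case is ★ `Modules/CechRefineMultiplicative.homologyMap_cupH`); `refineCochain_unit`, `homologyMap_refineComplexMap_unit`
  — any refinement carries the unit class `[1]` to `[1]`; `refineCochain_id_apply` — a pointwise-identity index map with restriction data
  acts as the identity on cochains; `hom_ext_apply`, `homologyMap_apply_eq_self_of`, `homologyMap_comp_apply`.
* §2 scheme-side tools for `pullbackSystemHom`: `adm_comp`, `hρ_comp` (composites), `pullbackSystemHom_congr` (data along EQUAL scheme
  maps), `pullbackSystemHom_comp_app` (the characterised composite datum `hφc` of ★ `refineCochain_comp`), `pullbackSystemHom_id_app`.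
* §3 `exists_eq_sum_cup_add_sysD` — if `cupH : Ȟᵃ ⊗ Ȟᵇ → Ȟ^{m+1}` is onto, every ordered `(m+1)`-cocycle is a finite sum of cups of
  cocycles plus a coboundary (★ `exists_eq_pairing_add_toCycles_of_surjective` read on cochains); `lift_curry`, `exists_d_apply_eq_sysD`.

[cite: StacksProject, Tag 01FG] [cite: StacksProject, Tag 01FP] [cite: Godement1958, II §6.6] [cite: MumfordAV1970, §13 Cor. 2 (p. 129)]
-/

noncomputable section

open CategoryTheory CategoryTheory.Limits AlgebraicGeometry TopologicalSpace Opposite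
open HomologicalComplex TensorProduct
open Literature.Algebra.Homology Literature.Algebra.Homology.OrderedCech

set_option backward.isDefEq.respectTransparency false

namespace Literature.AlgebraicGeometry.Modules

universe u

/-! ## §1 Class-level lemmas for `refineComplexMap` -/

section Refine

variable {ι ι' : Type} [LinearOrder ι] [LinearOrder ι'] {A : Type u} [CommRing A]
  {M : Finset ι ⥤ ModuleCat.{u} A} {M' : Finset ι' ⥤ ModuleCat.{u} A} (τ : ι' → ι) (φ : imageFunctor τ ⋙ M ⟶ M')
  {N P : Finset ι ⥤ ModuleCat.{u} A} {N' P' : Finset ι' ⥤ ModuleCat.{u} A}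
  {β : ∀ s : Finset ι, M.obj s →ₗ[A] N.obj s →ₗ[A] P.obj s}
  {β' : ∀ s' : Finset ι', M'.obj s' →ₗ[A] N'.obj s' →ₗ[A] P'.obj s'}
  (φN : imageFunctor τ ⋙ N ⟶ N') (φP : imageFunctor τ ⋙ P ⟶ P')

/-- **Refinement along a MONOTONE index map is multiplicative on classes** (from ★ `refineCochain_cup`; no Leray hypothesis). [cite: StacksProject, Tag 01FG] -/
theorem homologyMap_refineComplexMap_cupH (hτ : Monotone τ) (hβ : IsNaturalPairing β) (hβ' : IsNaturalPairing β')
    (hφ : ∀ (s' : Finset ι') (x : M.obj (s'.image τ)) (y : N.obj (s'.image τ)),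
      (φP.app s').hom (β (s'.image τ) x y) = β' s' ((φ.app s').hom x) ((φN.app s').hom y))
    (a b n : ℕ) (h : a + b = n) (y : (sysComplex M).homology (a : ℤ)) (z : (sysComplex N).homology (b : ℤ)) :
    (HomologicalComplex.homologyMap (refineComplexMap τ φP) (n : ℤ)).hom (cupH β hβ a b n h y z) =
      cupH β' hβ' a b n h ((HomologicalComplex.homologyMap (refineComplexMap τ φ) (a : ℤ)).hom y)
        ((HomologicalComplex.homologyMap (refineComplexMap τ φN) (b : ℤ)).hom z) := by
  obtain ⟨zy, rfl⟩ := homologyπ_surjective (sysComplex M) a y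
  obtain ⟨zz, rfl⟩ := homologyπ_surjective (sysComplex N) b z
  rw [cupH_π β hβ a b n h, homologyπ_refineComplexMap, homologyπ_refineComplexMap, homologyπ_refineComplexMap,
    cupH_π β' hβ' a b n h]
  refine congrArg ((sysComplex P').homologyπ (n : ℤ)).hom (cycles_ext _ _ ?_)
  rw [iCycles_cyclesMap_refineComplexMap, iCycles_cupCycles β hβ a b n h, iCycles_cupCycles β' hβ' a b n h,
    iCycles_cyclesMap_refineComplexMap, iCycles_cyclesMap_refineComplexMap]
  exact refineCochain_cup τ φ φN φP hτ hφ _ _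

omit [LinearOrder ι'] in
/-- Tuples of length `≤ 1` are strictly monotone. [folklore] -/
private theorem strictMono_of_fin_le_one {m : ℕ} (hm : m ≤ 1) (α : Fin m → ι) : StrictMono α := by
  intro i j hij
  exfalso
  have := i.2; have := j.2
  have : (i : ℕ) < j := hij
  omega

/-- **Refinement (along ANY index map) carries a unit `0`-cochain to the unit `0`-cochain.** [cite: StacksProject, Tag 01FG] -/
theorem refineCochain_unit (u : ∀ s : Finset ι, M.obj s) (u' : ∀ s' : Finset ι', M'.obj s')
    (hφu : ∀ s' : Finset ι', (φ.app s').hom (u (s'.image τ)) = u' s') :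
    refineCochain τ φ ((0 : ℕ) : ℤ) (fun σ => u σ.1) = (fun σ' => u' σ'.1 : SysCochain M' ((0 : ℕ) : ℤ)) := by
  funext σ'
  rw [refineCochain_apply, SysCochain.altEvalAt_of_strictMono _
      (strictMono_of_fin_le_one (ι := ι) (by have h2 := σ'.2.2; omega) _),
    image_comp_orderEmbOfFin']
  have himg : (σ'.1.image τ).Nonempty ∧ ((σ'.1.image τ).card : ℤ) = ((0 : ℕ) : ℤ) + 1 := by
    obtain ⟨c, hc⟩ := exists_eq_vertex σ'
    have h1 : σ'.1 = {c} := by rw [hc]; rfl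
    rw [h1, Finset.image_singleton]
    exact ⟨Finset.singleton_nonempty _, by simp⟩
  rw [SysCochain.ext0At_self (fun σ : Simplex ι ((0 : ℕ) : ℤ) => u σ.1) ⟨σ'.1.image τ, himg⟩]
  exact hφu σ'.1

/-- **`τ^*` preserves the unit class** (any index map): `H(refineComplexMap τ φ) [e] = [e']` for unit `0`-cycles `e`, `e'`. [cite: StacksProject, Tag 01FG] -/
theorem homologyMap_refineComplexMap_unit (u : ∀ s : Finset ι, M.obj s) (u' : ∀ s' : Finset ι', M'.obj s')
    (hφu : ∀ s' : Finset ι', (φ.app s').hom (u (s'.image τ)) = u' s')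
    (e : (sysComplex M).cycles ((0 : ℕ) : ℤ)) (he : ((sysComplex M).iCycles _).hom e = (fun σ => u σ.1 : SysCochain M _))
    (e' : (sysComplex M').cycles ((0 : ℕ) : ℤ))
    (he' : ((sysComplex M').iCycles _).hom e' = (fun σ' => u' σ'.1 : SysCochain M' _)) :
    (HomologicalComplex.homologyMap (refineComplexMap τ φ) ((0 : ℕ) : ℤ)).hom (((sysComplex M).homologyπ _).hom e) =
      ((sysComplex M').homologyπ _).hom e' := by
  rw [homologyπ_refineComplexMap]
  refine congrArg ((sysComplex M').homologyπ _).hom (cycles_ext _ _ ?_)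
  rw [iCycles_cyclesMap_refineComplexMap, he, he']
  exact refineCochain_unit τ φ u u' hφu


/-! ### Identity index maps; equality and composition of characterised chain maps -/

/-- **Refinement along a (pointwise) IDENTITY index map with restriction data is the identity on cochains.** [cite: StacksProject, Tag 01FG] -/
theorem refineCochain_id_apply (τ₀ : ι → ι) (hτ₀ : ∀ i, τ₀ i = i) (φ₀ : imageFunctor τ₀ ⋙ M ⟶ M)
    (himg : ∀ s : Finset ι, s.image τ₀ ⊆ s)
    (hφ₀ : ∀ (s : Finset ι) (x : M.obj (s.image τ₀)), (φ₀.app s).hom x = (M.map (homOfLE (himg s))).hom x)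
    (n : ℤ) (g : SysCochain M n) : refineCochain τ₀ φ₀ n g = g := by
  funext σ
  have hsm : StrictMono (τ₀ ∘ ⇑(σ.1.orderEmbOfFin rfl)) := by
    intro i j hij
    change τ₀ _ < τ₀ _
    rw [hτ₀, hτ₀]
    exact (σ.1.orderEmbOfFin rfl).strictMono hij
  have heq : σ.1.image τ₀ = σ.1 := by
    conv_rhs => rw [← Finset.image_id (s := σ.1)]
    exact Finset.image_congr fun i _ => hτ₀ i
  rw [refineCochain_apply, SysCochain.altEvalAt_of_strictMono _ hsm, image_comp_orderEmbOfFin', hφ₀,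
    SysCochain.map_ext0At g _ _ _ subset_rfl (himg σ.1), heq, SysCochain.ext0At_self]

/-- Two morphisms of ordered Čech complexes with the same action on cochains are equal. [folklore] [cite: StacksProject, Tag 01FG] -/
theorem hom_ext_apply {F G : sysComplex M ⟶ sysComplex M'} (h : ∀ (n : ℤ) (g : SysCochain M n), (F.f n).hom g = (G.f n).hom g) :
    F = G := by
  ext n g
  exact h n g

/-- A morphism of ordered Čech complexes acting as the identity on cochains induces the identity on classes. [folklore]
[cite: StacksProject, Tag 01FG] -/
theorem homologyMap_apply_eq_self_of {F : sysComplex M ⟶ sysComplex M} (h : ∀ (n : ℤ) (g : SysCochain M n), (F.f n).hom g = g)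
    (n : ℤ) (y : (sysComplex M).homology n) : (HomologicalComplex.homologyMap F n).hom y = y := by
  have hF : F = 𝟙 _ := hom_ext_apply (fun n g => h n g)
  rw [hF, HomologicalComplex.homologyMap_id]
  rfl

/-- Composition of pull-backs on ordered Čech classes, elementwise. [folklore] [cite: StacksProject, Tag 01FP] -/
theorem homologyMap_comp_apply (F : sysComplex M ⟶ sysComplex M')
    {L : CochainComplex (ModuleCat.{u} A) ℤ} (G : sysComplex M' ⟶ L) (n : ℤ) (y : (sysComplex M).homology n) :
    (HomologicalComplex.homologyMap G n).hom ((HomologicalComplex.homologyMap F n).hom y) =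
      (HomologicalComplex.homologyMap (F ≫ G) n).hom y := by
  rw [HomologicalComplex.homologyMap_comp]
  rfl

end Refine

/-! ## §2 Scheme-side tools for `pullbackSystemHom` -/

section SchemeTools

variable {X Y Z : Scheme.{u}} {ι ι' ι'' : Type} [LinearOrder ι] [LinearOrder ι'] [LinearOrder ι'']
  {A : Type u} [CommRing A]

omit [LinearOrder ι] [LinearOrder ι'] [LinearOrder ι''] in
/-- Admissibility of the composite index map of two refinements along scheme maps. [folklore] [cite: StacksProject, Tag 01FG] -/
theorem adm_comp (f : Y ⟶ X) (g : Z ⟶ Y) (U : ι → X.Opens) (V : ι' → Y.Opens) (W : ι'' → Z.Opens) (θ : ι' → ι)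
    (θ' : ι'' → ι') (hθ : ∀ c, V c ≤ f ⁻¹ᵁ U (θ c)) (hθ' : ∀ d, W d ≤ g ⁻¹ᵁ V (θ' d)) :
    ∀ d, W d ≤ (g ≫ f) ⁻¹ᵁ U ((θ ∘ θ') d) := fun d =>
  (hθ' d).trans (Scheme.Hom.preimage_mono g (hθ (θ' d)))

/-- Base rings along the composite of two scheme maps. [folklore] [cite: StacksProject, Tag 01FG] -/
theorem hρ_comp (f : Y ⟶ X) (g : Z ⟶ Y) (ρX : A →+* Γ(X, ⊤)) (ρY : A →+* Γ(Y, ⊤)) (ρZ : A →+* Γ(Z, ⊤))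
    (hρ : ∀ a, ρY a = f.appTop (ρX a)) (hρ' : ∀ a, ρZ a = g.appTop (ρY a)) :
    ∀ a, ρZ a = (g ≫ f).appTop (ρX a) := fun a => by
  rw [hρ', hρ, Scheme.Hom.comp_appTop]
  rfl

omit [LinearOrder ι'] in
/-- The pull-back data depend on the scheme map only through its value (proof irrelevance in `hθ`, `hρ`). [cite: StacksProject, Tag 01FG] -/
theorem pullbackSystemHom_congr {f f' : Y ⟶ X} (e : f = f') (U : ι → X.Opens) (V : ι' → Y.Opens) (θ : ι' → ι)
    (hθ : ∀ c, V c ≤ f ⁻¹ᵁ U (θ c)) (hθ' : ∀ c, V c ≤ f' ⁻¹ᵁ U (θ c)) (ρX : A →+* Γ(X, ⊤)) (ρY : A →+* Γ(Y, ⊤))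
    (hρ : ∀ a, ρY a = f.appTop (ρX a)) (hρ' : ∀ a, ρY a = f'.appTop (ρX a)) (s' : Finset ι')
    (x : SecMod (unitModule X) ρX (cechOpen U (s'.image θ))) :
    ((pullbackSystemHom f U V θ hθ ρX ρY hρ).app s').hom x = ((pullbackSystemHom f' U V θ hθ' ρX ρY hρ').app s').hom x := by
  subst e
  rfl

omit [LinearOrder ι''] in
/-- **The composite data**: `φ_{g ≫ f}` with the composite index map is `φ_g ∘ φ_f ∘ restriction` (the hypothesis `hφc`
of ★ `refineCochain_comp`). [cite: StacksProject, Tag 01FG] -/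
theorem pullbackSystemHom_comp_app (f : Y ⟶ X) (g : Z ⟶ Y) (U : ι → X.Opens) (V : ι' → Y.Opens) (W : ι'' → Z.Opens)
    (θ : ι' → ι) (θ' : ι'' → ι') (hθ : ∀ c, V c ≤ f ⁻¹ᵁ U (θ c)) (hθ' : ∀ d, W d ≤ g ⁻¹ᵁ V (θ' d))
    (hθθ' : ∀ d, W d ≤ (g ≫ f) ⁻¹ᵁ U ((θ ∘ θ') d))
    (ρX : A →+* Γ(X, ⊤)) (ρY : A →+* Γ(Y, ⊤)) (ρZ : A →+* Γ(Z, ⊤)) (hρ : ∀ a, ρY a = f.appTop (ρX a))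
    (hρ' : ∀ a, ρZ a = g.appTop (ρY a)) (hρρ' : ∀ a, ρZ a = (g ≫ f).appTop (ρX a)) (s'' : Finset ι'')
    (x : SecMod (unitModule X) ρX (cechOpen U (s''.image (θ ∘ θ')))) :
    ((pullbackSystemHom (g ≫ f) U W (θ ∘ θ') hθθ' ρX ρZ hρρ').app s'').hom x =
      ((pullbackSystemHom g V W θ' hθ' ρY ρZ hρ').app s'').hom
        (((pullbackSystemHom f U V θ hθ ρX ρY hρ).app (s''.image θ')).hom
          (((sectionsSystem U (unitModule X) ρX).map
            (homOfLE (Finset.image_image.symm.le : s''.image (θ ∘ θ') ⊆ (s''.image θ').image θ))).hom x)) := by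
  apply SecMod.toRing_injective ρZ
  rw [toRing_pullbackSystemHom_app, toRing_pullbackSystemHom_app, toRing_pullbackSystemHom_app, sectionsSystem_map_apply,
    SecMod.toRing_res]
  change _ = ((X.presheaf.map (homOfLE _).op ≫ f.appLE _ _ _) ≫ g.appLE _ _ _) (SecMod.toRing ρX x)
  rw [Scheme.Hom.map_appLE, Scheme.Hom.appLE_comp_appLE]

/-- The data of `𝟙` is restriction (the hypothesis `hφ₀` of `refineCochain_id_apply`). [cite: StacksProject, Tag 01FG] -/
theorem pullbackSystemHom_id_app (U : ι → X.Opens) (τ₀ : ι → ι) (himg : ∀ s : Finset ι, s.image τ₀ ⊆ s)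
    (hθ : ∀ c, U c ≤ (𝟙 X : X ⟶ X) ⁻¹ᵁ U (τ₀ c)) (ρX : A →+* Γ(X, ⊤)) (hρ : ∀ a, ρX a = (𝟙 X : X ⟶ X).appTop (ρX a))
    (s : Finset ι) (x : SecMod (unitModule X) ρX (cechOpen U (s.image τ₀))) :
    ((pullbackSystemHom (𝟙 X) U U τ₀ hθ ρX ρX hρ).app s).hom x =
      ((sectionsSystem U (unitModule X) ρX).map (homOfLE (himg s))).hom x := by
  apply SecMod.toRing_injective ρX
  rw [toRing_pullbackSystemHom_id, sectionsSystem_map_apply, SecMod.toRing_res]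
  rfl

end SchemeTools

/-! ## §3 The cocycle decomposition behind a surjective cup product -/

section Decomp

variable {ι : Type} [LinearOrder ι] {A : Type u} [CommRing A] {M N P : Finset ι ⥤ ModuleCat.{u} A}
  (β : ∀ s : Finset ι, M.obj s →ₗ[A] N.obj s →ₗ[A] P.obj s)

omit [LinearOrder ι] in
/-- `lift (curry f) = f`. [folklore] -/
private theorem lift_curry {V W Z : Type*} [AddCommGroup V] [Module A V] [AddCommGroup W] [Module A W] [AddCommGroup Z]
    [Module A Z] (f : V ⊗[A] W →ₗ[A] Z) : TensorProduct.lift (TensorProduct.curry f) = f :=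
  TensorProduct.ext' fun _ _ => rfl

/-- Transport of the differential to `sysD` across a propositional degree equality. [folklore] -/
private theorem exists_d_apply_eq_sysD (m : ℤ) {i : ℤ} (hi : i = m) (x : (sysComplex P).X i) :
    ∃ x' : SysCochain P m, ((sysComplex P).d i (m + 1)).hom x = sysD P m x' := by
  subst hi
  exact ⟨x, by rw [sysComplex_d]; rfl⟩

/-- **Cocycle decomposition from class-level surjectivity of the cup product**: if
`cupH : Ȟᵃ ⊗ Ȟᵇ → Ȟ^{m+1}` is onto, every ordered `(m+1)`-cocycle is a finite sum of cups of cocycles plus a coboundary. [cite: StacksProject, Tag 01FG] -/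
theorem exists_eq_sum_cup_add_sysD (hβ : IsNaturalPairing β) (a b m : ℕ) (h : a + b = m + 1)
    (hs : Function.Surjective (TensorProduct.lift (cupH β hβ a b (m + 1) h)))
    (g : SysCochain P ((m : ℤ) + 1)) (hg : sysD P _ g = 0) :
    ∃ (σ : Type u) (_ : Fintype σ) (za : σ → (sysComplex M).cycles (a : ℤ)) (zb : σ → (sysComplex N).cycles (b : ℤ))
      (x : SysCochain P (m : ℤ)),
      g = ∑ i, cup β a b ((m : ℤ) + 1) (((sysComplex M).iCycles _).hom (za i)) (((sysComplex N).iCycles _).hom (zb i))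
        + sysD P (m : ℤ) x := by
  classical
  -- `g` as a cycle of degree `↑(m+1)`
  obtain ⟨zg, hzg⟩ := exists_cycles_eq P ((m + 1 : ℕ) : ℤ) g hg
  -- surjectivity of the descended pairing
  unfold cupH at hs
  rw [lift_curry] at hs
  obtain ⟨t, x, hzx⟩ := exists_eq_pairing_add_toCycles_of_surjective _ _ _ _ _ _ _ _ _ _ _ _ hs zg
  obtain ⟨S, rfl⟩ := TensorProduct.exists_finset t
  -- the coboundary part in degree `↑m`
  obtain ⟨x', hx'⟩ := exists_d_apply_eq_sysD (P := P) (m : ℤ) (i := ((m + 1 : ℕ) : ℤ) - 1) (by push_cast; ring) x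
  refine ⟨↥S, inferInstance, fun i => i.1.1, fun i => i.1.2, x', ?_⟩
  -- apply `ι` to the cycle identity
  have hι := congrArg ((sysComplex P).iCycles _).hom hzx
  rw [hzg, map_add, map_sum, map_sum] at hι
  rw [hι, Finset.sum_coe_sort S (fun p => cup β a b ((m : ℤ) + 1) (((sysComplex M).iCycles _).hom p.1)
    (((sysComplex N).iCycles _).hom p.2))]
  congr 1
  · refine Finset.sum_congr rfl fun p _ => ?_
    exact iCycles_cupCycles β hβ a b (m + 1) h p.1 p.2
  · change (((sysComplex P).toCycles _ _) ≫ (sysComplex P).iCycles _).hom x = _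
    rw [toCycles_i]
    exact hx'

end Decomp

end Literature.AlgebraicGeometry.Modules

end
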